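import Literature.NumberTheory.QuadraticFields.IdealClassLatticeSums
import HarnessLib

/-!
# Genus theory of imaginary quadratic fields, I: the character `𝔞 ↦ (N𝔞 / p)` is a class invariant

Topic `NumberTheory/QuadraticFields`, namespace `Literature.NumberTheory.QuadraticFields.Quadratic`
(continuing `IdealClassLatticeSums.lean`: the form–ideal dictionary of an imaginary quadratic field).
Everything here is PROVED (one definition with body, theorems; no named facts).

Let `K` be an imaginary quadratic field of discriminant `D = d_K` and `p` an ODD prime dividing `D`.
Gauss's genus character attached to `p` is `ψ_p([𝔞]) = (N𝔞 / p)` (Legendre symbol) for integral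
`𝔞` of norm prime to `p`.  This file proves that it is WELL DEFINED on ideal classes — the heart of
genus theory that needs no composition of forms (Cox, *Primes of the form x² + ny²*, §3.B,
Lemma 3.13 / Thm. 3.15: "all values represented by `f` prime to `p` have the same Legendre symbol"):

* `formGenusValue p (A, B, C)` — Gauss's value of a form at `p`: `(A/p)` if `p ∤ A`, else `(C/p)`;
* `legendreSym_formValue_eq` — **Gauss's lemma**: for a primitive form `(A, B, C)` with
  `p ∣ B² − 4AC`, every value `n = Au² + Buv + Cv²` prime to `p` has `(n/p) = formGenusValue p (A,B,C)`
  (`4An = (2Au + Bv)² − (B² − 4AC)v²`, resp. `4Cn = (Bu + 2Cv)² − (B² − 4AC)u²` when `p ∣ A`);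
* `exists_absNorm_eq_formValue` — the norms of the integral ideals in the class `[𝔞_Q]⁻¹` are the
  values `Au² − Buv + Cv²` of the opposite form (`𝔞 𝔞_Q = (λ)`, `λ = uA + v(ω − k) ∈ 𝔞_Q`,
  `N(λ) = A(Au² − Buv + Cv²)`, `N𝔞_Q = A`; Cox Thm. 7.7 (7.16));
* `legendreSym_absNorm_eq_of_mk0_eq` — **class invariance**: integral ideals `𝔞, 𝔟 ≠ 0` in the same
  class with norms prime to `p` have `(N𝔞/p) = (N𝔟/p)`;
* `not_dvd_absNorm_of_isCoprime` — an ideal coprime to `(p)` has norm prime to `p`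
  (`N(1 − pr) ≡ 1 (mod p)`), so that every class has such representatives
  (the tree's `exists_isCoprime_mk0_eq`).

## References

* [Cox2013] D. A. Cox, *Primes of the form x² + ny²*, 2nd ed. (2013), §3.B Lemma 3.13, Thm. 3.15;
  §7.B Thm. 7.7 and (7.16).
* C. F. Gauss, *Disquisitiones Arithmeticae* (1801), artt. 229–233. [folklore]
-/

noncomputable section

open scoped nonZeroDivisors
open Module NumberField Finset
open Literature.NumberTheory.EllipticCurves
open Literature.NumberTheory.QuadraticFields.BinaryQuadraticForm (reducedForms mem_reducedForms_iff
  discr_apply IsPrimitive isPrimitive_iff)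

namespace Literature.NumberTheory.QuadraticFields.Quadratic

/-! ### Gauss's lemma on the values of a form -/

/-- **Gauss's value of a form at an odd prime `p` dividing its discriminant**: `(A/p)` if `p ∤ A`,
else `(C/p)` (Cox, §3.B: the "assigned character" of the form). [cite: Cox2013, §3.B Lemma 3.13] -/
def formGenusValue (p : ℕ) [Fact p.Prime] (Q : ℤ × ℤ × ℤ) : ℤ :=
  if (p : ℤ) ∣ Q.1 then legendreSym p Q.2.2 else legendreSym p Q.1

/-- Congruent integers have the same Legendre symbol. [folklore] -/
theorem legendreSym_eq_of_dvd_sub {p : ℕ} [Fact p.Prime] {a b : ℤ} (h : (p : ℤ) ∣ a - b) :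
    legendreSym p a = legendreSym p b := by
  rw [legendreSym.mod p a, legendreSym.mod p b]
  congr 1
  exact Int.emod_eq_emod_iff_emod_sub_eq_zero.mpr (Int.emod_eq_zero_of_dvd h)

/-- The core of Gauss's lemma: if `4Xn ≡ w² (mod p)` with `p ∤ 2Xn` then `(n/p) = (X/p)`. [folklore] -/
theorem legendreSym_eq_of_four_mul_mul_congr_sq {p : ℕ} [Fact p.Prime] (hp2 : p ≠ 2) {X n w : ℤ}
    (hX : ¬ (p : ℤ) ∣ X) (hn : ¬ (p : ℤ) ∣ n) (hcong : (p : ℤ) ∣ w ^ 2 - 4 * X * n) :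
    legendreSym p n = legendreSym p X := by
  have hp : Prime (p : ℤ) := Nat.prime_iff_prime_int.mp (Fact.out : p.Prime)
  have hp2' : ¬ (p : ℤ) ∣ 2 := by
    intro h
    have hle : (p : ℤ) ≤ 2 := Int.le_of_dvd (by norm_num) h
    have hge : (2 : ℤ) ≤ p := by exact_mod_cast (Fact.out : p.Prime).two_le
    have : (p : ℤ) = 2 := le_antisymm hle hge
    exact hp2 (by exact_mod_cast this)
  have hp4 : ¬ (p : ℤ) ∣ 4 := by
    intro h
    have h' : (p : ℤ) ∣ 2 * 2 := by norm_num; exact h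
    rcases hp.dvd_or_dvd h' with h2 | h2 <;> exact hp2' h2
  have hprod : ¬ (p : ℤ) ∣ 4 * X * n := by
    intro h
    rcases hp.dvd_or_dvd h with h1 | h1
    · rcases hp.dvd_or_dvd h1 with h2 | h2
      · exact hp4 h2
      · exact hX h2
    · exact hn h1
  have hw : ¬ (p : ℤ) ∣ w := by
    intro h
    have hw2 : (p : ℤ) ∣ w ^ 2 := dvd_pow h two_ne_zero
    have : (p : ℤ) ∣ w ^ 2 - (w ^ 2 - 4 * X * n) := dvd_sub hw2 hcong
    exact hprod (by simpa using this)
  have hz : ∀ {a : ℤ}, ¬ (p : ℤ) ∣ a → ((a : ZMod p) ≠ 0) := fun ha h ↦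
    ha ((ZMod.intCast_zmod_eq_zero_iff_dvd _ p).mp h)
  have h1 : legendreSym p (4 * X * n) = 1 := by
    rw [← legendreSym_eq_of_dvd_sub hcong]
    exact legendreSym.sq_one' p (hz hw)
  have h4sq : legendreSym p 4 = 1 := by
    rw [show (4 : ℤ) = 2 ^ 2 by norm_num]
    exact legendreSym.sq_one' p (hz hp2')
  rw [legendreSym.mul, legendreSym.mul, h4sq, one_mul] at h1
  have hX2 : legendreSym p X ^ 2 = 1 := legendreSym.sq_one p (hz hX)
  calc legendreSym p n = legendreSym p X ^ 2 * legendreSym p n := by rw [hX2, one_mul]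
    _ = legendreSym p X * (legendreSym p X * legendreSym p n) := by ring
    _ = legendreSym p X := by rw [h1, mul_one]

/-- **Gauss's lemma** (Cox, Lemma 3.13 in the case needed for genus theory): let `p` be an odd prime
and `(A, B, C)` a primitive form with `p ∣ B² − 4AC`.  Then every value `n = Au² + Buv + Cv²` prime
to `p` has the same Legendre symbol `(n/p) = formGenusValue p (A, B, C)`.
[cite: Cox2013, §3.B Lemma 3.13] -/
theorem legendreSym_formValue_eq {p : ℕ} [Fact p.Prime] (hp2 : p ≠ 2) {A B C : ℤ}
    (hprim : IsPrimitive (A, B, C)) (hdisc : (p : ℤ) ∣ B ^ 2 - 4 * A * C) (u v : ℤ)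
    (hn : ¬ (p : ℤ) ∣ A * u ^ 2 + B * u * v + C * v ^ 2) :
    legendreSym p (A * u ^ 2 + B * u * v + C * v ^ 2) = formGenusValue p (A, B, C) := by
  have hp : Prime (p : ℤ) := Nat.prime_iff_prime_int.mp (Fact.out : p.Prime)
  set n : ℤ := A * u ^ 2 + B * u * v + C * v ^ 2 with hndef
  by_cases hA : (p : ℤ) ∣ A
  · -- `p ∣ A`: then `p ∣ B`, `p ∤ C`, and `4Cn = (Bu + 2Cv)² − (B² − 4AC)u²`
    rw [formGenusValue, if_pos hA]
    have hB : (p : ℤ) ∣ B := by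
      have : (p : ℤ) ∣ B ^ 2 := by
        have h4 : (p : ℤ) ∣ 4 * A * C := dvd_mul_of_dvd_left (dvd_mul_of_dvd_right hA 4) C
        have := dvd_add hdisc h4; simpa using this
      exact hp.dvd_of_dvd_pow this
    have hC : ¬ (p : ℤ) ∣ C := by
      intro hC
      rw [isPrimitive_iff] at hprim
      have h1 : ((p : ℕ) : ℤ) ∣ ((Int.gcd (Int.gcd A B) C : ℕ) : ℤ) :=
        Int.dvd_coe_gcd (Int.dvd_coe_gcd hA hB) hC
      rw [hprim] at h1
      exact hp.not_dvd_one (by exact_mod_cast h1)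
    refine legendreSym_eq_of_four_mul_mul_congr_sq hp2 hC hn (w := B * u + 2 * C * v) ?_
    have e : (B * u + 2 * C * v) ^ 2 - 4 * C * n = (B ^ 2 - 4 * A * C) * u ^ 2 := by rw [hndef]; ring
    rw [e]; exact dvd_mul_of_dvd_left hdisc _
  · -- `p ∤ A`: `4An = (2Au + Bv)² − (B² − 4AC)v²`
    rw [formGenusValue, if_neg hA]
    refine legendreSym_eq_of_four_mul_mul_congr_sq hp2 hA hn (w := 2 * A * u + B * v) ?_
    have e : (2 * A * u + B * v) ^ 2 - 4 * A * n = (B ^ 2 - 4 * A * C) * v ^ 2 := by rw [hndef]; ring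
    rw [e]; exact dvd_mul_of_dvd_left hdisc _

/-- The opposite form `(A, −B, C)` is primitive with the form. [folklore] -/
theorem isPrimitive_neg {A B C : ℤ} (h : IsPrimitive (A, B, C)) : IsPrimitive (A, -B, C) := by
  rw [isPrimitive_iff] at h ⊢
  rwa [Int.gcd_neg]

/-! ### Norms of the ideals of a class are values of a form -/

section Field

variable {K : Type*} [Field K] [NumberField K]

/-- **Norms in the class `[𝔞_Q]⁻¹` are values of the opposite form** (Cox, Thm. 7.7 (7.16)): for an
integral basis `(1, ω)`, `ω² = m + tω`, `t² + 4m < 0`, a reduced form `Q = (A, B, C)` of discriminant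
`t² + 4m` with ideal `𝔞_Q = (A, ω − (B+t)/2)`, and a nonzero integral ideal `𝔞` with
`[𝔞] = [𝔞_Q]⁻¹`, there are integers `u, v` with `N𝔞 = Au² − Buv + Cv²`.
[cite: Cox2013, §7.B Thm. 7.7 and (7.16)] -/
theorem exists_absNorm_eq_formValue (b : Basis (Fin 2) ℤ (𝓞 K)) (hb : b 0 = 1) {t m : ℤ}
    (hω : b 1 * b 1 = (m : 𝓞 K) + (t : 𝓞 K) * b 1) (hneg : t ^ 2 + 4 * m < 0)
    (Q : reducedForms (t ^ 2 + 4 * m)) {I : Ideal (𝓞 K)} (hI : I ∈ (Ideal (𝓞 K))⁰)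
    (hcls : ClassGroup.mk0 ⟨I, hI⟩ = (ClassGroup.mk0 ⟨_, formIdeal_mem_nonZeroDivisors b hb hneg Q⟩)⁻¹) :
    ∃ u v : ℤ, (Ideal.absNorm I : ℤ) =
      (Q : ℤ × ℤ × ℤ).1 * u ^ 2 - (Q : ℤ × ℤ × ℤ).2.1 * u * v + (Q : ℤ × ℤ × ℤ).2.2 * v ^ 2 := by
  obtain ⟨hdiscQ, hA, -, -⟩ := (mem_reducedForms_iff hneg).1 Q.2
  rw [discr_apply] at hdiscQ
  set A : ℤ := (Q : ℤ × ℤ × ℤ).1 with hAdef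
  set Bq : ℤ := (Q : ℤ × ℤ × ℤ).2.1 with hBdef
  set C : ℤ := (Q : ℤ × ℤ × ℤ).2.2 with hCdef
  set k : ℤ := (Bq + t) / 2 with hk
  have h2k : 2 * k = Bq + t := two_mul_ediv_two_of_disc_eq hdiscQ
  have hn : A * C = k ^ 2 - t * k - m := norm_eq_of_disc_eq hdiscQ h2k
  set 𝔟 : Ideal (𝓞 K) := Ideal.span {(A : 𝓞 K), b 1 - (k : 𝓞 K)} with h𝔟
  obtain ⟨x, hx, hIx⟩ := ClassGroup.mk0_eq_mk0_inv_iff.1 hcls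
  change I * 𝔟 = Ideal.span {x} at hIx
  -- `x ∈ 𝔟`, with lattice coordinates
  have hmem : x ∈ 𝔟 := by
    have : x ∈ I * 𝔟 := by rw [hIx]; exact Ideal.mem_span_singleton_self _
    exact Ideal.mul_le_left this
  obtain ⟨u, v, huv⟩ := (mem_span_pair_iff_of_basis b hb hω hn x).1 hmem
  refine ⟨u, v, ?_⟩
  -- norms
  have h1 : Ideal.absNorm (I * 𝔟) = (Algebra.norm ℤ x).natAbs := by
    rw [hIx, Ideal.absNorm_span_singleton]
  rw [map_mul] at h1
  have h2 : Algebra.norm ℤ x = A * (A * u ^ 2 + (t - 2 * k) * u * v + C * v ^ 2) := by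
    rw [huv, norm_lattice_elt b hb hω hn]
  have h𝔟N : (Ideal.absNorm 𝔟 : ℤ) = A := by
    rw [h𝔟, absNorm_span_pair_eq b hb hω hn, Int.natCast_natAbs, abs_of_pos hA]
  have hval_nonneg : 0 ≤ A * u ^ 2 + (t - 2 * k) * u * v + C * v ^ 2 := by
    have e : 4 * A * (A * u ^ 2 + (t - 2 * k) * u * v + C * v ^ 2) =
        (2 * A * u + (t - 2 * k) * v) ^ 2 + (4 * A * C - (t - 2 * k) ^ 2) * v ^ 2 := by ring
    have hq : 0 < 4 * A * C - (t - 2 * k) ^ 2 := by nlinarith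
    nlinarith [sq_nonneg (2 * A * u + (t - 2 * k) * v), sq_nonneg v]
  have h3 : ((Ideal.absNorm I * Ideal.absNorm 𝔟 : ℕ) : ℤ) = A * (A * u ^ 2 + (t - 2 * k) * u * v + C * v ^ 2) := by
    rw [h1, h2, Int.natCast_natAbs, abs_of_nonneg (mul_nonneg hA.le hval_nonneg)]
  push_cast at h3
  rw [h𝔟N] at h3
  have h4 : (Ideal.absNorm I : ℤ) = A * u ^ 2 + (t - 2 * k) * u * v + C * v ^ 2 := by
    have := mul_right_cancel₀ hA.ne' (h3.trans (mul_comm _ _))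
    exact this
  rw [h4]
  have hB : t - 2 * k = -Bq := by linarith
  rw [hB]; ring

/-- **`(N𝔞 / p)` is constant on an ideal class** of an imaginary quadratic field, for an odd prime
`p ∣ d_K` and ideals of norm prime to `p` (Gauss's genus character; Cox Thm. 3.15 transported to
ideals by Thm. 7.7). [cite: Cox2013, §3.B Thm. 3.15] -/
theorem legendreSym_absNorm_eq_of_mk0_eq (hK : IsImaginaryQuadratic K) {p : ℕ} [Fact p.Prime]
    (hp2 : p ≠ 2) (hpd : (p : ℤ) ∣ NumberField.discr K)
    {I J : Ideal (𝓞 K)} (hI : I ∈ (Ideal (𝓞 K))⁰) (hJ : J ∈ (Ideal (𝓞 K))⁰)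
    (hcls : ClassGroup.mk0 ⟨I, hI⟩ = ClassGroup.mk0 ⟨J, hJ⟩)
    (hpI : ¬ (p : ℤ) ∣ Ideal.absNorm I) (hpJ : ¬ (p : ℤ) ∣ Ideal.absNorm J) :
    legendreSym p (Ideal.absNorm I) = legendreSym p (Ideal.absNorm J) := by
  obtain ⟨b, hb⟩ := exists_basis_zero_eq_one (K := K) hK.1
  set m : ℤ := b.repr (b 1 * b 1) 0 with hm
  set t : ℤ := b.repr (b 1 * b 1) 1 with ht
  have hω : b 1 * b 1 = (m : 𝓞 K) + (t : 𝓞 K) * b 1 := basis_one_mul_self_eq b hb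
  have hDK : NumberField.discr K = t ^ 2 + 4 * m := discr_eq_sq_add_four_mul b hb
  have hneg : t ^ 2 + 4 * m < 0 := hDK ▸ hK.discr_neg
  -- a reduced form `Q` with `[𝔞_Q] = [I]⁻¹`
  obtain ⟨Q, hQ⟩ := (reducedForms_mk0_bijective b hb hω hneg).2 (ClassGroup.mk0 ⟨I, hI⟩)⁻¹
  dsimp only at hQ
  have hI' : ClassGroup.mk0 ⟨I, hI⟩ = (ClassGroup.mk0 ⟨_, formIdeal_mem_nonZeroDivisors b hb hneg Q⟩)⁻¹ := by
    rw [hQ, inv_inv]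
  have hJ' : ClassGroup.mk0 ⟨J, hJ⟩ = (ClassGroup.mk0 ⟨_, formIdeal_mem_nonZeroDivisors b hb hneg Q⟩)⁻¹ := by
    rw [← hcls, hI']
  obtain ⟨u, v, huv⟩ := exists_absNorm_eq_formValue b hb hω hneg Q hI hI'
  obtain ⟨u', v', huv'⟩ := exists_absNorm_eq_formValue b hb hω hneg Q hJ hJ'
  obtain ⟨hdiscQ, -, hprim, -⟩ := (mem_reducedForms_iff hneg).1 Q.2
  rw [discr_apply] at hdiscQ
  set A : ℤ := (Q : ℤ × ℤ × ℤ).1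
  set Bq : ℤ := (Q : ℤ × ℤ × ℤ).2.1
  set C : ℤ := (Q : ℤ × ℤ × ℤ).2.2
  have hprim' : IsPrimitive (A, -Bq, C) := isPrimitive_neg hprim
  have hdisc' : (p : ℤ) ∣ (-Bq) ^ 2 - 4 * A * C := by
    rw [neg_sq, hdiscQ, ← hDK]; exact hpd
  have e1 : (Ideal.absNorm I : ℤ) = A * u ^ 2 + (-Bq) * u * v + C * v ^ 2 := by rw [huv]; ring
  have e2 : (Ideal.absNorm J : ℤ) = A * u' ^ 2 + (-Bq) * u' * v' + C * v' ^ 2 := by rw [huv']; ring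
  rw [e1] at hpI ⊢
  rw [e2] at hpJ ⊢
  rw [legendreSym_formValue_eq hp2 hprim' hdisc' u v hpI, legendreSym_formValue_eq hp2 hprim' hdisc' u' v' hpJ]

/-! ### Ideals prime to `(p)` have norm prime to `p` -/

/-- `N(1 + p r) ≡ 1 (mod p)` for `r ∈ 𝓞 K`, `[K : ℚ] = 2` (the norm form `x² + txy − my²` of an
integral basis `(1, ω)`). [folklore] -/
theorem dvd_norm_one_add_mul_sub_one (h2 : finrank ℚ K = 2) (p : ℤ) (r : 𝓞 K) :
    p ∣ Algebra.norm ℤ (1 + (p : 𝓞 K) * r) - 1 := by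
  obtain ⟨b, hb⟩ := exists_basis_zero_eq_one (K := K) h2
  set m : ℤ := b.repr (b 1 * b 1) 0 with hm
  set t : ℤ := b.repr (b 1 * b 1) 1 with ht
  have hω : b 1 * b 1 = (m : 𝓞 K) + (t : 𝓞 K) * b 1 := basis_one_mul_self_eq b hb
  obtain ⟨r₀, r₁, hr⟩ : ∃ r₀ r₁ : ℤ, r = (r₀ : 𝓞 K) + (r₁ : 𝓞 K) * b 1 :=
    ⟨_, _, eq_repr_add_repr_mul_of_basis b hb r⟩
  have e : 1 + (p : 𝓞 K) * r = ((1 + p * r₀ : ℤ) : 𝓞 K) + ((p * r₁ : ℤ) : 𝓞 K) * b 1 := by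
    rw [hr]; push_cast; ring
  rw [e, norm_intCast_add_intCast_mul b hb hω]
  exact ⟨2 * r₀ + p * r₀ ^ 2 + t * r₁ + t * p * r₀ * r₁ - m * p * r₁ ^ 2, by ring⟩

/-- **An ideal coprime to `(p)` has norm prime to `p`** (`[K : ℚ] = 2`): if `𝔞 + (p) = 1`, write
`1 = a + pr` with `a ∈ 𝔞`; then `N𝔞 ∣ N(a)` and `N(a) = N(1 − pr) ≡ 1 (mod p)`. [folklore] -/
theorem not_dvd_absNorm_of_isCoprime (h2 : finrank ℚ K = 2) {p : ℕ} (hp : p.Prime) {I : Ideal (𝓞 K)}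
    (hcop : IsCoprime I (Ideal.span {(p : 𝓞 K)})) : ¬ (p : ℤ) ∣ Ideal.absNorm I := by
  intro hdvd
  obtain ⟨a, ha, c, hc, hac⟩ := Ideal.isCoprime_iff_exists.mp hcop
  obtain ⟨r, hr⟩ := Ideal.mem_span_singleton'.mp hc
  have ha' : a = 1 + (((p : ℤ)) : 𝓞 K) * (-r) := by
    have : a = 1 - c := by rw [← hac]; ring
    rw [this, ← hr]; push_cast; ring
  have h1 : (Ideal.absNorm I : ℤ) ∣ Algebra.norm ℤ a := Ideal.absNorm_dvd_norm_of_mem ha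
  have h2' : (p : ℤ) ∣ Algebra.norm ℤ a - 1 := by
    rw [ha']; exact dvd_norm_one_add_mul_sub_one h2 (p : ℤ) (-r)
  have h3 : (p : ℤ) ∣ Algebra.norm ℤ a := hdvd.trans h1
  have h4 : (p : ℤ) ∣ 1 := by
    have := dvd_sub h3 h2'; simpa using this
  have hp1 : (p : ℤ) ≤ 1 := Int.le_of_dvd one_pos h4
  have := hp.two_le
  omega

end Field

end Literature.NumberTheory.QuadraticFields.Quadratic

end
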